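import Summits.CriticalPhenomena.PercolationContinuityZ3.Theorems.PercNearOneGluingNoHeavyLowerTailHullPortTASPrelim
import Summits.CriticalPhenomena.PercolationContinuityZ3.Theorems.PercNearOneGluingNoHeavyLowerTailHullPortTABase
import HarnessLib

/-!
# `NoHeavyLowerTail` (stmt-CriticalPhenomena-4575) — owner-set `T_A ≥ 0`: base case and the double induction

Support file (prover `prim-hp-7`; `--supports stmt-CriticalPhenomena-4575`); no definitions, named facts or sorries.
Continues `…HullPortTASPrelim`: degenerate cases, the base case (no positive pair leaves the avoided set `X`), `Δ̂_N ≥ 0`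
(`deltaNS_nonneg`) and the strong induction on `(|V ∖ X|, #positive boundary pairs)` — verbatim prim-ineq-prove-5's
`HullPort.taQ_nonneg_of_Pv` with the owner set `S` (cell memos HP7-HTW-PROOF.md §4–§5, HP7-MDLX-PROOF §5):
`HullPort.taQS_nonneg_of_starH : 0 ≤ taQS …` for all weights `< 1`, every avoided set `X` and every marker `o`, given
(★^H) at singletons (`hStarH`, prim-hp-8 PROOF-S5-ALL-R (K7); tree: `CovTauStarN.starH_ED`, prim-ineq-prove-1).
`taQS ≥ 0` is (Htw) = the (K9)-diagonal of PROOF-S5-ALL-R in cleared form (`b·(A − p·B)`).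
[cite: VandenbergHaggstromKahn2005, Thm. 1.3 (p. 6), §2.1 — corollaries; the induction is prim-hp-7's (cell memo)]
-/

noncomputable section

namespace Summit.CriticalPhenomena.PercolationContinuityZ3.Theorems

open MeasureTheory Set Literature.Probability.LatticeModels Literature.Probability.Percolation
open scoped Classical

variable {V : Type*}

namespace HullPort

open LonePortSum LonePortSumGeneral BHK2006 DecisionTree KNPreFKG KNSep

section TAS

variable [Fintype V]

/-! ### Degenerate cases and the base case -/

/-- `b_{X ∪ {v′}} = b_X − a^{(v′)}_X` (owner set): `μ(v ↮ S, X, v′) = μ(v ↮ S, X) − μ(v ↮ S, X; v ↔ v′)`. [folklore] -/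
theorem tabS_insert_eq (w : Sym2 V → ℝ) (S : Set V) (v v' : V) (X : Set V) :
    tabS w S v (insert v' X) = tabS w S v X - taaS w S v v' X := by
  simp only [tabS, taaS, ← Finset.sum_sub_distrib]
  refine Finset.sum_congr rfl fun ω _ => ?_
  rw [avoidEv_union_insert_eq, ind_inter_compl, ind_inter]
  ring

/-- `b_X > 0` when `v ∉ S ∪ X` and all weights are `< 1` (the empty configuration contributes). [folklore] -/
theorem tabS_pos (w : Sym2 V → ℝ) (hw0 : ∀ e, 0 ≤ w e) (hw : ∀ e, w e < 1) (S : Set V) (v : V) (X : Set V)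
    (hv : v ∉ S ∪ X) : 0 < tabS w S v X := by
  have hw1 : ∀ e, w e ≤ 1 := fun e => (hw e).le
  have hmem : (∅ : Set (Sym2 V)) ∈ avoidEv v (S ∪ X) := by
    intro t ht h
    rw [reachable_empty_iff] at h
    exact hv (h ▸ ht)
  calc 0 < weight w (∅ : Set (Sym2 V)) * ind (avoidEv v (S ∪ X)) ∅ := by
        rw [ind_of_mem hmem, mul_one]; exact weight_empty_pos w hw
    _ ≤ tabS w S v X :=
        Finset.single_le_sum (f := fun ω => weight w ω * ind (avoidEv v (S ∪ X)) ω)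
          (fun ω _ => mul_nonneg (weight_nonneg hw0 hw1 ω) (ind_nonneg _ _)) (Finset.mem_univ _)

/-- If `v ∈ X` (and `v ∉ S`) then `c ≡ 0` (in `G − cut_X`, `v` is isolated, so `{v ↔ S}` is impossible). [folklore] -/
theorem taCS_eq_zero_of_mem (w : Sym2 V → ℝ) (x : V) (S : Set V) (v : V) (hvS : v ∉ S) (X : Set V) (hv : v ∈ X)
    (g : Set (Sym2 V) → ℝ) (ω : Set (Sym2 V)) : taCS w x S v X g ω = 0 := by
  have hY : ∀ η : Set (Sym2 V), ind (connS S v : Set (Set (Sym2 V))) (η \ cut X ω) = 0 := by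
    intro η
    refine ind_of_not_mem fun h => ?_
    obtain ⟨u, huS, hvu⟩ := h
    have hiso : ∀ e ∈ η \ cut X ω, v ∉ e := fun e he hve => he.2 (mem_cut_of_mem hv hve ω)
    have := eq_of_reachable_of_isolated hiso u hvu
    exact hvS (this ▸ huS)
  simp only [taCS, delE, hY, mul_zero, Finset.sum_const_zero, sub_zero]

/-- If `v ∈ X` then `B = 0` (owner set). [folklore] -/
theorem taBS_eq_zero_of_mem (w : Sym2 V → ℝ) (x : V) (S : Set V) (v : V) (hvS : v ∉ S) (X : Set V) (hv : v ∈ X)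
    (g : Set (Sym2 V) → ℝ) : taBS w x S v X g = 0 :=
  Finset.sum_eq_zero fun ω _ => by rw [taCS_eq_zero_of_mem w x S v hvS X hv g ω]; ring

/-- If `v ∈ X` then `A = 0` (owner set). [folklore] -/
theorem taAS_eq_zero_of_mem (w : Sym2 V → ℝ) (x : V) (S : Set V) (v o : V) (hvS : v ∉ S) (X : Set V) (hv : v ∈ X)
    (g : Set (Sym2 V) → ℝ) : taAS w x S v o X g = 0 :=
  Finset.sum_eq_zero fun ω _ => by rw [taCS_eq_zero_of_mem w x S v hvS X hv g ω]; ring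

/-- If `v ∈ S ∪ X` then `b = 0` (owner set). [folklore] -/
theorem tabS_eq_zero_of_mem (w : Sym2 V → ℝ) (S : Set V) (v : V) (X : Set V) (hv : v ∈ S ∪ X) : tabS w S v X = 0 :=
  Finset.sum_eq_zero fun ω _ => by
    rw [ind_of_not_mem fun h => (h : ∀ t ∈ S ∪ X, ¬ (openGraph ω).Reachable v t) v hv
      (SimpleGraph.Reachable.refl _), mul_zero]

/-- If `v ∈ S ∪ X` then `a = 0` (owner set). [folklore] -/
theorem taaS_eq_zero_of_mem (w : Sym2 V → ℝ) (S : Set V) (v o : V) (X : Set V) (hv : v ∈ S ∪ X) :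
    taaS w S v o X = 0 :=
  Finset.sum_eq_zero fun ω _ => by
    rw [ind_of_not_mem fun h => (h.1 : ∀ t ∈ S ∪ X, ¬ (openGraph ω).Reachable v t) v hv
      (SimpleGraph.Reachable.refl _), mul_zero]

/-- If `x ∈ X` then `B = 0` (`{x ↮ X}` is empty) (owner set). [folklore] -/
theorem taBS_eq_zero_of_root_mem (w : Sym2 V → ℝ) (x : V) (S : Set V) (v : V) (X : Set V) (hx : x ∈ X)
    (g : Set (Sym2 V) → ℝ) : taBS w x S v X g = 0 :=
  Finset.sum_eq_zero fun ω _ => by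
    rw [ind_of_not_mem fun h => (h : ∀ t ∈ X, ¬ (openGraph ω).Reachable x t) x hx (SimpleGraph.Reachable.refl _)]
    ring

/-- If `x ∈ X` then `A = 0` (owner set). [folklore] -/
theorem taAS_eq_zero_of_root_mem (w : Sym2 V → ℝ) (x : V) (S : Set V) (v o : V) (X : Set V) (hx : x ∈ X)
    (g : Set (Sym2 V) → ℝ) : taAS w x S v o X g = 0 :=
  Finset.sum_eq_zero fun ω _ => by
    rw [ind_of_not_mem fun h => (h : ∀ t ∈ X, ¬ (openGraph ω).Reachable x t) x hx (SimpleGraph.Reachable.refl _)]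
    ring

/-- **Base case of the owner-set induction** (cell memo prim-hp-7 HP7-HTW-PROOF.md §5): if every non-loop pair joining `X`
to `V ∖ X` has weight `0`, then `Q = A·b − a·B = 0`. [folklore] -/
theorem taQS_eq_zero_of_noBoundary (w : Sym2 V → ℝ) (hw0 : ∀ e, 0 ≤ w e) (hw1 : ∀ e, w e ≤ 1)
    (hm : ∑ ω, weight w ω = 1) (x : V) (S : Set V) (v o : V) (X : Set V) (g : Set (Sym2 V) → ℝ)
    (hbd : ∀ e : Sym2 V, ¬ e.IsDiag → ∀ a ∈ e, ∀ b ∈ e, a ∈ X → b ∉ X → w e = 0) :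
    taQS w x S v o X g = 0 := by
  classical
  by_cases hx : x ∈ X
  · simp only [taQS, taAS_eq_zero_of_root_mem w x S v o X hx, taBS_eq_zero_of_root_mem w x S v X hx]; ring
  by_cases hvT : v ∈ S ∪ X
  · simp only [taQS, tabS_eq_zero_of_mem w S v X hvT, taaS_eq_zero_of_mem w S v o X hvT]; ring
  have hvX : v ∉ X := fun h => hvT (Set.mem_union_right _ h)
  have hnb : ∀ η : Set (Sym2 V), ∀ e ∈ η \ {e | w e = 0}, ¬ e.IsDiag → ∀ a ∈ e, ∀ b ∈ e, a ∈ X → b ∈ X := by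
    intro η e he hd a ha b hb haX
    by_contra hbX
    exact he.2 (hbd e hd a ha b hb haX hbX)
  have hcut : ∀ η : Set (Sym2 V), cut X (η \ {e | w e = 0}) = {e | ∃ u ∈ e, u ∈ X} :=
    fun η => cut_eq_of_noBoundary (hnb η)
  have hD : ∀ η : Set (Sym2 V), η \ {e | w e = 0} ∈ avoidEv x X := fun η t ht hxt =>
    hx (mem_of_reachable_of_noBoundary (hnb η) ht hxt.symm)
  set c₀ : ℝ := delE w {e | ∃ u ∈ e, u ∈ X} (fun η => g (openEdgeCluster η x) * ind (connS S v) η) -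
    delE w {e | ∃ u ∈ e, u ∈ X} (fun η => g (openEdgeCluster η x)) *
      delE w {e | ∃ u ∈ e, u ∈ X} (ind (connS S v)) with hc₀
  set n₀ : ℝ := delE w {e | ∃ u ∈ e, u ∈ X} (ind (connS S v : Set (Set (Sym2 V)))ᶜ) with hn₀
  set nw₀ : ℝ := delE w {e | ∃ u ∈ e, u ∈ X} (ind ((connS S v : Set (Set (Sym2 V)))ᶜ ∩ openConn v o))
    with hnw₀
  have hB : taBS w x S v X g = c₀ := by
    rw [taBS, sum_weight_eq_sum_sdiff_zeros w]
    have h1 : ∀ η : Set (Sym2 V), weight w η * (fun ω => ind (avoidEv x X) ω * taCS w x S v X g ω) (η \ {e | w e = 0}) =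
        weight w η * c₀ := by
      intro η; simp only; rw [ind_of_mem (hD η), one_mul, taCS, hcut η]
    rw [Finset.sum_congr rfl fun η _ => h1 η, ← Finset.sum_mul, hm, one_mul]
  have hA : taAS w x S v o X g = nw₀ / n₀ * c₀ := by
    rw [taAS, sum_weight_eq_sum_sdiff_zeros w]
    have h1 : ∀ η : Set (Sym2 V), weight w η * (fun ω => ind (avoidEv x X) ω *
        (taNWS w S v o X ω / taNS w S v X ω * taCS w x S v X g ω)) (η \ {e | w e = 0}) = weight w η * (nw₀ / n₀ * c₀) := by
      intro η; simp only; rw [ind_of_mem (hD η), one_mul, taCS, taNS, taNWS, hcut η]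
    rw [Finset.sum_congr rfl fun η _ => h1 η, ← Finset.sum_mul, hm, one_mul]
  have hconn : ∀ (η : Set (Sym2 V)) (t : V),
      (openGraph ((η \ {e | w e = 0}) \ {e | ∃ u ∈ e, u ∈ X})).Reachable v t ↔
        (openGraph (η \ {e | w e = 0})).Reachable v t :=
    fun η t => reachable_sdiff_iff_of_noBoundary (hnb η) hvX t
  have hE : ∀ η : Set (Sym2 V), ind (avoidEv v (S ∪ X)) (η \ {e | w e = 0}) =
      ind (connS S v : Set (Set (Sym2 V)))ᶜ ((η \ {e | w e = 0}) \ {e | ∃ u ∈ e, u ∈ X}) := by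
    intro η
    by_cases h : η \ {e | w e = 0} ∈ avoidEv v (S ∪ X)
    · rw [ind_of_mem h, ind_of_mem]
      rintro ⟨u, huS, hvu⟩
      exact h u (Set.mem_union_left _ huS) ((hconn η u).1 hvu)
    · rw [ind_of_not_mem h, ind_of_not_mem]
      intro hN
      apply h
      intro t ht hvt
      rcases ht with ht | ht
      · exact hN ⟨t, ht, (hconn η t).2 hvt⟩
      · exact hvX (mem_of_reachable_of_noBoundary (hnb η) ht hvt.symm)
  have hb : tabS w S v X = n₀ := by
    rw [tabS, sum_weight_eq_sum_sdiff_zeros w, hn₀, delE,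
      sum_weight_eq_sum_sdiff_zeros w (fun η => ind _ (η \ {e | ∃ u ∈ e, u ∈ X}))]
    exact Finset.sum_congr rfl fun η _ => by rw [hE η]
  have ha : taaS w S v o X = nw₀ := by
    rw [taaS, sum_weight_eq_sum_sdiff_zeros w, hnw₀, delE,
      sum_weight_eq_sum_sdiff_zeros w (fun η => ind _ (η \ {e | ∃ u ∈ e, u ∈ X}))]
    refine Finset.sum_congr rfl fun η _ => ?_
    rw [ind_inter, ind_inter, hE η]
    congr 1
    by_cases h : η \ {e | w e = 0} ∈ openConn v o
    · have h' : (η \ {e | w e = 0}) \ {e | ∃ u ∈ e, u ∈ X} ∈ openConn v o :=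
        ((hconn η o).2 h : (openGraph _).Reachable v o)
      rw [ind_of_mem h, ind_of_mem h']
    · have h' : (η \ {e | w e = 0}) \ {e | ∃ u ∈ e, u ∈ X} ∉ openConn v o := fun hh => h ((hconn η o).1 hh)
      rw [ind_of_not_mem h, ind_of_not_mem h']
  have hle : nw₀ ≤ n₀ := by
    simp only [hnw₀, hn₀, delE]
    refine Finset.sum_le_sum fun η _ => mul_le_mul_of_nonneg_left ?_ (weight_nonneg hw0 hw1 η)
    rw [ind_inter]
    have h1 := ind_le_one (openConn v o : Set (BondConfig V)) (η \ {e | ∃ u ∈ e, u ∈ X})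
    have h2 := ind_nonneg (connS S v : Set (Set (Sym2 V)))ᶜ (η \ {e | ∃ u ∈ e, u ∈ X})
    nlinarith [ind_nonneg (openConn v o : Set (BondConfig V)) (η \ {e | ∃ u ∈ e, u ∈ X}),
      ind_le_one (connS S v : Set (Set (Sym2 V)))ᶜ (η \ {e | ∃ u ∈ e, u ∈ X})]
  have hnw0 : 0 ≤ nw₀ := by
    simp only [hnw₀, delE]
    exact Finset.sum_nonneg fun η _ => mul_nonneg (weight_nonneg hw0 hw1 η) (ind_nonneg _ _)
  rw [taQS, hA, hB, ha, hb]
  by_cases hn : n₀ = 0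
  · have : nw₀ = 0 := le_antisymm (hn ▸ hle) hnw0
    rw [this, hn]; ring
  · field_simp
    ring


/-! ### The induction -/

/-- **`Δ̂_N ≥ 0` (owner set)** (cell memo prim-hp-7 HP7-HTW-PROOF.md §4): `B₀ b₁ − B₁ b₀ = Q(S₀; marker v′) + b₀·(B₀ − A^{(v′)}₀ − B₁) ≥ 0`.
[folklore] -/
theorem deltaNS_nonneg (w : Sym2 V → unitInterval) (hw : ∀ e, (w e : ℝ) < 1) (x : V) (S : Set V) (v v' : V)
    (X : Set V) (g : Set (Sym2 V) → ℝ)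
    (hStarH : ∀ (q : Sym2 V → unitInterval), (∀ e, (q e : ℝ) < 1) → ∀ u : V,
      taBS (fun e => (q e : ℝ)) x S v {u} g ≤
        (1 - delE (fun e => (q e : ℝ)) ∅ (ind ((connS S v : Set (Set (Sym2 V)))ᶜ ∩ openConn v u)) /
              delE (fun e => (q e : ℝ)) ∅ (ind (connS S v : Set (Set (Sym2 V)))ᶜ)) *
          (delE (fun e => (q e : ℝ)) ∅ (fun η => g (openEdgeCluster η x) * ind (connS S v) η) -
            delE (fun e => (q e : ℝ)) ∅ (fun η => g (openEdgeCluster η x)) *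
              delE (fun e => (q e : ℝ)) ∅ (ind (connS S v))))
    (hQv : 0 ≤ taQS (fun e => (w e : ℝ)) x S v v' X g) :
    0 ≤ taBS (fun e => (w e : ℝ)) x S v X g * tabS (fun e => (w e : ℝ)) S v (insert v' X) -
      taBS (fun e => (w e : ℝ)) x S v (insert v' X) g * tabS (fun e => (w e : ℝ)) S v X := by
  have hII := taBS_insert_le w hw x S v v' X g hStarH
  have hw0 : ∀ e, 0 ≤ (w e : ℝ) := fun e => (w e).2.1
  have hw1 : ∀ e, (w e : ℝ) ≤ 1 := fun e => (w e).2.2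
  have hb0 : 0 ≤ tabS (fun e => (w e : ℝ)) S v X :=
    Finset.sum_nonneg fun ω _ => mul_nonneg (weight_nonneg hw0 hw1 ω) (ind_nonneg _ _)
  rw [tabS_insert_eq]
  rw [taQS] at hQv
  have e1 : taBS (fun e => (w e : ℝ)) x S v X g * (tabS (fun e => (w e : ℝ)) S v X - taaS (fun e => (w e : ℝ)) S v v' X) -
      taBS (fun e => (w e : ℝ)) x S v (insert v' X) g * tabS (fun e => (w e : ℝ)) S v X =
      (taAS (fun e => (w e : ℝ)) x S v v' X g * tabS (fun e => (w e : ℝ)) S v X -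
        taaS (fun e => (w e : ℝ)) S v v' X * taBS (fun e => (w e : ℝ)) x S v X g) +
      (taBS (fun e => (w e : ℝ)) x S v X g - taAS (fun e => (w e : ℝ)) x S v v' X g -
        taBS (fun e => (w e : ℝ)) x S v (insert v' X) g) * tabS (fun e => (w e : ℝ)) S v X := by ring
  rw [e1]
  exact add_nonneg hQv (mul_nonneg (by linarith) hb0)

/-- **`T^S ≥ 0` in the form `Q = A·b − a·B ≥ 0`** (prim-hp-7, cell memo HP7-HTW-PROOF.md §5 = HP7-MDLX-PROOF §5 with the
owner set `S`): for every weight vector with all weights `< 1`, every avoided set `X`, every marker `o`, given the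
within-bound (★^H) at singletons (`hStarH`, prim-hp-8's (K7)).  Strong induction on
`(|V ∖ X|, #{non-loop pairs of positive weight joining X to V ∖ X})`, verbatim as in `taQ_nonneg_of_Pv`.
[folklore; the argument is prim-hp-7's (cell memo)] -/
theorem taQS_nonneg_of_starH (x : V) (S : Set V) (v : V) (hvS : v ∉ S) (g : Set (Sym2 V) → ℝ)
    (hStarH : ∀ (q : Sym2 V → unitInterval), (∀ e, (q e : ℝ) < 1) → ∀ u : V,
      taBS (fun e => (q e : ℝ)) x S v {u} g ≤
        (1 - delE (fun e => (q e : ℝ)) ∅ (ind ((connS S v : Set (Set (Sym2 V)))ᶜ ∩ openConn v u)) /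
              delE (fun e => (q e : ℝ)) ∅ (ind (connS S v : Set (Set (Sym2 V)))ᶜ)) *
          (delE (fun e => (q e : ℝ)) ∅ (fun η => g (openEdgeCluster η x) * ind (connS S v) η) -
            delE (fun e => (q e : ℝ)) ∅ (fun η => g (openEdgeCluster η x)) *
              delE (fun e => (q e : ℝ)) ∅ (ind (connS S v))))
    (w : Sym2 V → unitInterval) (hw : ∀ e, (w e : ℝ) < 1) (X : Set V) (o : V) :
    0 ≤ taQS (fun e => (w e : ℝ)) x S v o X g := by
  classical
  set M : ℕ := Fintype.card (Sym2 V) with hM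
  have main : ∀ (N : ℕ) (w : Sym2 V → unitInterval), (∀ e, (w e : ℝ) < 1) → ∀ (X : Set V),
      (Finset.univ.filter (fun u : V => u ∉ X)).card * (M + 1) +
        (Finset.univ.filter (fun e : Sym2 V => ¬ e.IsDiag ∧ (∃ a ∈ e, a ∈ X) ∧ (∃ b ∈ e, b ∉ X) ∧
          0 < (w e : ℝ))).card = N → ∀ o : V, 0 ≤ taQS (fun e => (w e : ℝ)) x S v o X g := by
    intro N
    induction N using Nat.strong_induction_on with
    | _ N ih =>
    intro w hw X hN o
    set ŵ : Sym2 V → ℝ := fun e => (w e : ℝ) with hŵ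
    have hw0 : ∀ e, 0 ≤ ŵ e := fun e => (w e).2.1
    have hw1 : ∀ e, ŵ e ≤ 1 := fun e => (w e).2.2
    have hm : ∑ ω, weight ŵ ω = 1 := by
      have h1 := integral_prodBernoulli_eq_sum w fun _ => (1 : ℝ)
      simp only [integral_const, probReal_univ, smul_eq_mul, mul_one] at h1
      exact h1.symm
    set F : Finset (Sym2 V) := Finset.univ.filter (fun e : Sym2 V => ¬ e.IsDiag ∧ (∃ a ∈ e, a ∈ X) ∧
      (∃ b ∈ e, b ∉ X) ∧ 0 < (w e : ℝ)) with hF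
    by_cases hF0 : F = ∅
    · have hbd : ∀ e : Sym2 V, ¬ e.IsDiag → ∀ a ∈ e, ∀ b ∈ e, a ∈ X → b ∉ X → ŵ e = 0 := by
        intro e hd a ha b hb haX hbX
        by_contra hne
        have hpos : 0 < (w e : ℝ) := lt_of_le_of_ne (hw0 e) (Ne.symm hne)
        have : e ∈ F := by
          rw [hF, Finset.mem_filter]
          exact ⟨Finset.mem_univ _, hd, ⟨a, ha, haX⟩, ⟨b, hb, hbX⟩, hpos⟩
        rw [hF0] at this
        exact absurd this (Finset.notMem_empty _)
      rw [taQS_eq_zero_of_noBoundary ŵ hw0 hw1 hm x S v o X g hbd]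
    · obtain ⟨e₀, he₀⟩ := Finset.nonempty_iff_ne_empty.2 hF0
      have he₀' := (Finset.mem_filter.1 he₀).2
      obtain ⟨hdiag, ⟨x₀, hx₀e, hx₀X⟩, ⟨v', hve, hvX⟩, hpos⟩ := he₀'
      have hx₀v : x₀ ≠ v' := fun h => hvX (h ▸ hx₀X)
      have he₀eq : e₀ = s(x₀, v') := (Sym2.mem_and_mem_iff hx₀v).1 ⟨hx₀e, hve⟩
      set w₀ : Sym2 V → unitInterval := Function.update w e₀ 0 with hw₀def
      set ŵ₀ : Sym2 V → ℝ := fun e => (w₀ e : ℝ) with hŵ₀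
      have he0 : ŵ₀ s(x₀, v') = 0 := by
        simp only [hŵ₀, hw₀def, ← he₀eq, Function.update_self]; rfl
      have hoff : ∀ f, f ≠ s(x₀, v') → ŵ₀ f = ŵ f := by
        intro f hf
        simp only [hŵ₀, hw₀def, hŵ]
        rw [Function.update_of_ne (he₀eq ▸ hf)]
      have hw₀lt : ∀ e, (w₀ e : ℝ) < 1 := by
        intro e
        by_cases h : e = e₀
        · subst h; simp only [hw₀def, Function.update_self]; norm_num
        · simp only [hw₀def, Function.update_of_ne h]; exact hw e
      have hN0 : (Finset.univ.filter (fun u : V => u ∉ X)).card * (M + 1) +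
          (Finset.univ.filter (fun e : Sym2 V => ¬ e.IsDiag ∧ (∃ a ∈ e, a ∈ X) ∧ (∃ b ∈ e, b ∉ X) ∧
            0 < (w₀ e : ℝ))).card < N := by
        rw [← hN]
        apply Nat.add_lt_add_left
        apply Finset.card_lt_card
        refine ⟨fun f hf => ?_, fun hsub => ?_⟩
        · rw [Finset.mem_filter] at hf ⊢
          obtain ⟨_, hd, ha, hb, hp⟩ := hf
          have hfe : f ≠ e₀ := by
            rintro rfl
            simp only [hw₀def, Function.update_self] at hp
            exact absurd hp (by norm_num)
          refine ⟨Finset.mem_univ _, hd, ha, hb, ?_⟩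
          simpa only [hw₀def, Function.update_of_ne hfe] using hp
        · have := (Finset.mem_filter.1 (hsub he₀)).2.2.2.2
          simp only [hw₀def, Function.update_self] at this
          exact absurd this (by norm_num)
      have hN1 : (Finset.univ.filter (fun u : V => u ∉ insert v' X)).card * (M + 1) +
          (Finset.univ.filter (fun e : Sym2 V => ¬ e.IsDiag ∧ (∃ a ∈ e, a ∈ insert v' X) ∧
            (∃ b ∈ e, b ∉ insert v' X) ∧ 0 < (w₀ e : ℝ))).card < N := by
        rw [← hN]
        have hn : (Finset.univ.filter (fun u : V => u ∉ insert v' X)).card + 1 ≤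
            (Finset.univ.filter (fun u : V => u ∉ X)).card := by
          rw [Nat.add_one_le_iff]
          apply Finset.card_lt_card
          refine ⟨fun u hu => ?_, fun hsub => ?_⟩
          · rw [Finset.mem_filter] at hu ⊢
            exact ⟨hu.1, fun h => hu.2 (Set.mem_insert_of_mem _ h)⟩
          · have := (Finset.mem_filter.1 (hsub (Finset.mem_filter.2 ⟨Finset.mem_univ v', hvX⟩))).2
            exact this (Set.mem_insert _ _)
        have hm' : (Finset.univ.filter (fun e : Sym2 V => ¬ e.IsDiag ∧ (∃ a ∈ e, a ∈ insert v' X) ∧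
            (∃ b ∈ e, b ∉ insert v' X) ∧ 0 < (w₀ e : ℝ))).card ≤ M :=
          (Finset.card_le_univ _).trans (le_of_eq rfl)
        calc (Finset.univ.filter (fun u : V => u ∉ insert v' X)).card * (M + 1) +
              (Finset.univ.filter (fun e : Sym2 V => ¬ e.IsDiag ∧ (∃ a ∈ e, a ∈ insert v' X) ∧
                (∃ b ∈ e, b ∉ insert v' X) ∧ 0 < (w₀ e : ℝ))).card
            < (Finset.univ.filter (fun u : V => u ∉ insert v' X)).card * (M + 1) + (M + 1) := by
              linarith
          _ = ((Finset.univ.filter (fun u : V => u ∉ insert v' X)).card + 1) * (M + 1) := by ring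
          _ ≤ (Finset.univ.filter (fun u : V => u ∉ X)).card * (M + 1) := Nat.mul_le_mul_right _ hn
          _ ≤ _ := Nat.le_add_right _ _
      have hQ00 : 0 ≤ taQS ŵ₀ x S v o X g := ih _ hN0 w₀ hw₀lt X rfl o
      have hQ11 : 0 ≤ taQS ŵ₀ x S v o (insert v' X) g := by
        refine ih _ ?_ w₀ hw₀lt (insert v' X) rfl o
        convert hN1 using 6
      have hQv : 0 ≤ taQS ŵ₀ x S v v' X g := ih _ hN0 w₀ hw₀lt X rfl v'
      have sA := taAS_section ŵ ŵ₀ x S v o x₀ v' X hx₀X he0 hoff g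
      have sB := taBS_section ŵ ŵ₀ x S v x₀ v' X hx₀X he0 hoff g
      have sa := taaS_section ŵ ŵ₀ S v o x₀ v' X hx₀X he0 hoff
      have sb := tabS_section ŵ ŵ₀ S v x₀ v' X hx₀X he0 hoff
      have ht0 : 0 ≤ ŵ s(x₀, v') := hw0 _
      have ht1 : ŵ s(x₀, v') ≤ 1 := hw1 _
      rw [taQS, sA, sB, sa, sb]
      have hL2 := lemma2S_avoidance w₀ S v o v' X hvS
      have hΔ := deltaNS_nonneg w₀ hw₀lt x S v v' X g hStarH hQv
      rw [taQS] at hQ00 hQ11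
      by_cases hvv : v ∈ insert v' X
      · have hA1 := taAS_eq_zero_of_mem ŵ₀ x S v o hvS (insert v' X) hvv g
        have hB1 := taBS_eq_zero_of_mem ŵ₀ x S v hvS (insert v' X) hvv g
        have ha1 := taaS_eq_zero_of_mem ŵ₀ S v o (insert v' X) (Set.mem_union_right _ hvv)
        have hb1 := tabS_eq_zero_of_mem ŵ₀ S v (insert v' X) (Set.mem_union_right _ hvv)
        exact bernstein_step_degenerate _ _ _ _ _ _ _ _ (ŵ s(x₀, v')) hQ00 hA1 hB1 ha1 hb1
      · have hvX' : v ∉ S ∪ X := by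
          intro h
          rcases h with h | h
          · exact hvS h
          · exact hvv (Set.mem_insert_of_mem _ h)
        have hvvX : v ∉ S ∪ insert v' X := by
          intro h
          rcases h with h | h
          · exact hvS h
          · exact hvv h
        have hw₀0 : ∀ e, 0 ≤ ŵ₀ e := fun e => (w₀ e).2.1
        have hb0 := tabS_pos ŵ₀ hw₀0 hw₀lt S v X hvX'
        have hb1 := tabS_pos ŵ₀ hw₀0 hw₀lt S v (insert v' X) hvvX
        exact bernstein_step _ _ _ _ _ _ _ _ (ŵ s(x₀, v')) ht0 ht1 hQ00 hQ11 hΔ (by linarith [hL2]) hb0 hb1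
  exact main _ w hw X rfl o

end TAS

end HullPort

end Summit.CriticalPhenomena.PercolationContinuityZ3.Theorems
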